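import Mathlib
import Summits.ValiantsHypothesis.ValiantsHypothesis.Theorems.LiouvilleSarnakAlignedTypeICharactersMod2nDefs
import Literature.NumberTheory.LFunctions.KlurmanMangerelTeravainenShortAPs
import HarnessLib

/-!
# Route LiouvilleSarnak — support `AlignedTypeI` (stmt-ValiantsHypothesis-21040), line `characters_mod_2n`:
# stub `stub_kmtVariance` from Klurman–Mangerel–Teräväinen 2023, Theorem 1.3 (named fact)

The registered stub `stub_kmtVariance : KMTVariance` of the line `Cruxes/AlignedTypeI/Lines/characters_mod_2n.lean`
is the planner's "cite-grade" reading of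

> O. Klurman, A. P. Mangerel, J. Teräväinen, *Multiplicative functions in short arithmetic progressions*,
> Proc. London Math. Soc. (3) 127 (2023) 366–446 (doi:10.1112/plms.12546, arXiv:1909.12280, held), §1.3,
> **Theorem 1.3** (smooth moduli, NO exceptional set): "Let `1 ≤ Q ≤ x/10`, `(log(x/Q))^{-1/200} ≤ ε ≤ 1`, and
> `ε' = exp(-ε^{-4})`. Let `q ≤ Q` be `q^{ε'}`-smooth and `(x/Q)^{ε²}`-typical. Let `f : ℕ → 𝕌` be a multiplicative
> function. Let `χ₁ (mod q)` be the character minimizing the distance `inf_{|t| ≤ log x} 𝔻_q(f, χ(n)n^{it}; x)`. Then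
> `Σ*_{a (mod q)} |Σ_{n ≤ x, n ≡ a (q)} f(n) − (χ₁(a)/φ(q)) Σ_{n ≤ x} f(n) χ̄₁(n)|² ≪ ε φ(q) (x/q)²`."

(§1.3: "an integer `q ≥ 1` is `y`-typical if `Σ_{p ∣ q, p ≤ z} 1 ≤ π(z)/100` for all `z ≥ y`"; "`q^{ε'}`-smooth" = all
prime factors `≤ q^{ε'}`; `Σ*` = sum over reduced residues; the implied constant is absolute.)

§1: the SPECIAL CASE `f = λ` (Liouville), `q = Q = 2^k` of Theorem 1.3 is the tree's named fact
`Literature.NumberTheory.LFunctions.KMT2023_theorem13_liouville_twoPower` (a `def … : Prop`, statement-only, NOT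
proved in the tree — Matomäki–Radziwiłł-in-progressions depth; sibling of
`Literature.NumberTheory.LFunctions.KMT2023_corollary17_liouville_twoPower`, Corollary 1.7 for `λ` and `2`-power
moduli): for `q = 2^k` (`k ≥ 1`, one prime factor) "`q^{ε'}`-smooth" reads `2 ≤ (2^k)^{ε'}` and
"`(x/Q)^{ε²}`-typical" reads `π((x/2^k)^{ε²}) ≥ 100`, i.e. `(x/2^k)^{ε²} ≥ 541` (the 100th prime), both kept as
hypotheses in that form; the minimising character is quantified existentially.

§2–§3 PROVE `KMTVariance` FROM that fact (`kmtVariance_of_KMT13`): at `x = 2^(n+k)`, `q = Q = 2^k` one has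
`x/q = 2^n`, the class of a unit `u` in `[1, x]` is `{u.val + 2^k b : b < 2^n}` (`sum_units_progression_eq`), the
hypotheses of Theorem 1.3 hold for `k ≥ k₀(ε) = ⌈exp(ε₁^{-4})⌉` and `n ≥ n₀(ε)`, and `C₀ ε₁ φ(2^k) 4^n ≤ ε 2^k 4^n`
for `ε₁ = min 1 (ε/C₀)`.

HONEST FRAMING. `kmtVariance_of_KMT13` is CONDITIONAL on the named fact (no `_holds` in the tree); the registered
stub is therefore NOT closed by name here, `AlignedTypeI` is not closed, and nothing here bears on `VP ≠ VNP`
(NOT proved).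
-/

set_option linter.dupNamespace false

noncomputable section

namespace Summit.ValiantsHypothesis.ValiantsHypothesis.Theorems.LiouvilleSarnak.AlignedTypeI.CharactersModTwoN

open ArithmeticFunction Finset
open scoped BigOperators

/-! ## §1 The named fact

The input is the tree's named fact `Literature.NumberTheory.LFunctions.KMT2023_theorem13_liouville_twoPower`
(Klurman–Mangerel–Teräväinen 2023, Theorem 1.3, for `f = λ` and `q = Q = 2^k`; landed p814770, statement-only —
NOT proved in the tree), taken below as a hypothesis. -/

/-! ## §2 Bookkeeping: classes of units along `b < 2^n`, and the ranges -/

/-- For `1 ≤ a ≤ q`, the progression `a, a+q, …, a+q(N-1)` is exactly the class of `a` in `[1, qN]`. [folklore] -/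
theorem image_progression_eq_filter {q a N : ℕ} (ha1 : 1 ≤ a) (haq : a ≤ q) :
    (Finset.range N).image (fun b => a + q * b) =
      (Finset.Icc 1 (q * N)).filter (fun m : ℕ => (m : ZMod q) = (a : ZMod q)) := by
  have hq : 0 < q := lt_of_lt_of_le ha1 haq
  ext m
  simp only [Finset.mem_image, Finset.mem_range, Finset.mem_filter, Finset.mem_Icc]
  constructor
  · rintro ⟨b, hb, rfl⟩
    refine ⟨⟨by omega, ?_⟩, ?_⟩
    · calc a + q * b ≤ q + q * (N - 1) := by
            gcongr
            omega
        _ = q * N := by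
            obtain ⟨N', rfl⟩ : ∃ N', N = N' + 1 := ⟨N - 1, by omega⟩
            simp [mul_add, add_comm]
    · push_cast
      simp
  · rintro ⟨⟨hm1, hmN⟩, hmod⟩
    rw [ZMod.natCast_eq_natCast_iff] at hmod
    -- `m ≡ a (mod q)` with `1 ≤ a ≤ q`, `1 ≤ m`: then `a ≤ m`
    have ham : a ≤ m := by
      by_contra hlt
      rw [not_le] at hlt
      -- `m < a ≤ q` and `m ≡ a (mod q)` force `m % q = a % q`; but `m % q = m` and `a % q ∈ {a, 0}`
      have h1 : m % q = a % q := hmod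
      rw [Nat.mod_eq_of_lt (lt_of_lt_of_le hlt haq)] at h1
      rcases haq.lt_or_eq with h | h
      · rw [Nat.mod_eq_of_lt h] at h1; omega
      · rw [h, Nat.mod_self] at h1; omega
    have hdvd : q ∣ m - a := (Nat.modEq_iff_dvd' ham).1 hmod.symm
    obtain ⟨b, hb⟩ := hdvd
    refine ⟨b, ?_, by omega⟩
    -- `a + q b = m ≤ q N` with `a ≥ 1` gives `b < N`
    by_contra hbN
    rw [not_lt] at hbN
    have : q * N ≤ q * b := Nat.mul_le_mul_left q hbN
    omega

/-- `Σ_{b < N} f(a + q b) = Σ_{1 ≤ m ≤ qN, m ≡ a (q)} f(m)` for `1 ≤ a ≤ q`. [folklore] -/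
theorem sum_progression_eq_sum_filter {M : Type*} [AddCommMonoid M] (f : ℕ → M) {q a N : ℕ}
    (ha1 : 1 ≤ a) (haq : a ≤ q) :
    ∑ b ∈ Finset.range N, f (a + q * b) =
      ∑ m ∈ (Finset.Icc 1 (q * N)).filter (fun m : ℕ => (m : ZMod q) = (a : ZMod q)), f m := by
  have hq : 0 < q := lt_of_lt_of_le ha1 haq
  rw [← image_progression_eq_filter ha1 haq, Finset.sum_image]
  intro b₁ _ b₂ _ h
  have h' : a + q * b₁ = a + q * b₂ := h
  exact Nat.eq_of_mul_eq_mul_left hq (by omega : q * b₁ = q * b₂)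

/-- The stub's class sum of a unit `u (mod 2^k)` along `b < 2^n` is the sum of `λ` over the class of `u` in
`[1, 2^(n+k)]`. [folklore] -/
theorem sum_units_progression_eq (n k : ℕ) (u : (ZMod (2 ^ k))ˣ) (hk : 1 ≤ k) :
    (∑ b : Fin (2 ^ n), ((liouville ((u : ZMod (2 ^ k)).val + 2 ^ k * (b : ℕ)) : ℤ) : ℂ)) =
      ∑ m ∈ (Finset.Icc 1 ⌊((2 : ℝ) ^ (n + k))⌋₊).filter
          (fun m : ℕ => (m : ZMod (2 ^ k)) = (u : ZMod (2 ^ k))), (liouville m : ℂ) := by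
  haveI : NeZero (2 ^ k) := ⟨pow_ne_zero _ two_ne_zero⟩
  haveI : Fact (1 < 2 ^ k) := ⟨Nat.one_lt_two_pow (by omega)⟩
  have hfloor : ⌊((2 : ℝ) ^ (n + k))⌋₊ = 2 ^ k * 2 ^ n := by
    rw [show ((2 : ℝ) ^ (n + k)) = ((2 ^ (n + k) : ℕ) : ℝ) by push_cast; rfl, Nat.floor_natCast, pow_add,
      mul_comm]
  set a : ℕ := (u : ZMod (2 ^ k)).val with ha
  have ha1 : 1 ≤ a := by
    rw [Nat.one_le_iff_ne_zero, ha, ne_eq, ZMod.val_eq_zero]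
    exact Units.ne_zero u
  have haq : a ≤ 2 ^ k := (ZMod.val_lt _).le
  have hcast : ((a : ℕ) : ZMod (2 ^ k)) = (u : ZMod (2 ^ k)) := by rw [ha, ZMod.natCast_zmod_val]
  rw [hfloor, Fin.sum_univ_eq_sum_range (fun b => ((liouville (a + 2 ^ k * b) : ℤ) : ℂ)) (2 ^ n),
    sum_progression_eq_sum_filter (fun m => ((liouville m : ℤ) : ℂ)) ha1 haq, hcast]

/-- The stub's main-term sum over `m : Fin (2^(n+k))` at `m + 1` is the sum over `1 ≤ m ≤ 2^(n+k)`. [folklore] -/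
theorem sum_fin_succ_eq_sum_Icc {M : Type*} [AddCommMonoid M] (f : ℕ → M) (N : ℕ) :
    ∑ m : Fin N, f ((m : ℕ) + 1) = ∑ m ∈ Finset.Icc 1 N, f m := by
  rw [Fin.sum_univ_eq_sum_range (fun i => f (i + 1)) N, Finset.range_eq_Ico, Finset.sum_Ico_add' f 0 N 1,
    zero_add]
  have hI : Finset.Ico 1 (N + 1) = Finset.Icc 1 N := by
    ext m
    simp only [Finset.mem_Ico, Finset.mem_Icc]
    omega
  rw [hI]

/-! ## §3 `KMTVariance` from the fact -/

/-- **`KMTVariance` from Klurman–Mangerel–Teräväinen 2023, Theorem 1.3** (`f = λ`, `q = Q = 2^k`, `x = 2^(n+k)`):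
CONDITIONAL on the named fact `Literature.NumberTheory.LFunctions.KMT2023_theorem13_liouville_twoPower`.  Given `ε > 0` put `ε₁ = min 1 (ε/C₀)`,
`k₀ = ⌈exp(ε₁^{-4})⌉ + 1` (so `2 ≤ (2^k)^{exp(-ε₁^{-4})}` for `k ≥ k₀`) and `n₀` with `2^n ≥ 10`,
`(n log 2)^{-1/200} ≤ ε₁` and `(2^n)^{ε₁²} ≥ 541` for `n ≥ n₀`; then the theorem's bound
`C₀ ε₁ φ(2^k) (2^n)² ≤ ε 2^k 4^n`. [cite: KlurmanMangerelTeravainen2023ShortAPs, Theorem 1.3] -/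
theorem kmtVariance_of_KMT13
    (hKMT : Literature.NumberTheory.LFunctions.KMT2023_theorem13_liouville_twoPower) : KMTVariance := by
  obtain ⟨C₀, hC₀, hT⟩ := hKMT
  intro ε hε
  -- constants
  set ε₁ : ℝ := min 1 (ε / C₀) with hε₁
  have hε₁0 : 0 < ε₁ := lt_min one_pos (div_pos hε hC₀)
  have hε₁1 : ε₁ ≤ 1 := min_le_left _ _
  have hε₁C : C₀ * ε₁ ≤ ε := by
    calc C₀ * ε₁ ≤ C₀ * (ε / C₀) := mul_le_mul_of_nonneg_left (min_le_right _ _) hC₀.le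
      _ = ε := by field_simp
  set e' : ℝ := Real.exp (-(ε₁⁻¹ ^ 4)) with he'
  have he'0 : 0 < e' := Real.exp_pos _
  have hlog2 : 0 < Real.log 2 := Real.log_pos one_lt_two
  -- thresholds
  obtain ⟨K, hK⟩ := exists_nat_ge (e'⁻¹)
  obtain ⟨N₁, hN₁⟩ := exists_nat_ge (ε₁⁻¹ ^ (200 : ℕ) / Real.log 2)
  obtain ⟨N₂, hN₂⟩ := exists_nat_ge (10 / (ε₁ ^ 2))
  refine ⟨max K 1, max (max N₁ N₂) 4, fun n hn k hk₀ hkn => ?_⟩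
  have hk1 : 1 ≤ k := le_trans (le_max_right _ _) hk₀
  have hkK : (K : ℝ) ≤ k := by exact_mod_cast le_trans (le_max_left _ _) hk₀
  have hn4 : 4 ≤ n := le_trans (le_max_right _ _) hn
  have hnN₁ : (N₁ : ℝ) ≤ n := by exact_mod_cast le_trans ((le_max_left _ _).trans (le_max_left _ _)) hn
  have hnN₂ : (N₂ : ℝ) ≤ n := by exact_mod_cast le_trans ((le_max_right _ _).trans (le_max_left _ _)) hn
  -- the parameters of Theorem 1.3
  set x : ℝ := (2 : ℝ) ^ (n + k) with hx
  have hxq : x / 2 ^ k = 2 ^ n := by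
    rw [hx, pow_add, mul_div_assoc, div_self (pow_ne_zero _ two_ne_zero), mul_one]
  have h2n10 : (10 : ℝ) ≤ 2 ^ n := by
    calc (10 : ℝ) ≤ 2 ^ 4 := by norm_num
      _ ≤ 2 ^ n := pow_le_pow_right₀ (by norm_num) hn4
  have hx10 : (10 : ℝ) * 2 ^ k ≤ x := by
    rw [hx, pow_add, mul_comm ((2 : ℝ) ^ n), mul_comm (10 : ℝ)]
    exact mul_le_mul_of_nonneg_left h2n10 (by positivity)
  -- `(log 2^n)^{-1/200} ≤ ε₁`
  have hlogn : Real.log (x / 2 ^ k) = n * Real.log 2 := by rw [hxq, Real.log_pow]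
  have hnlog : ε₁⁻¹ ^ (200 : ℕ) ≤ n * Real.log 2 := by
    have := le_trans hN₁ hnN₁
    rwa [div_le_iff₀ hlog2] at this
  have hεlog : Real.log (x / 2 ^ k) ^ (-(1 / 200 : ℝ)) ≤ ε₁ := by
    rw [hlogn]
    have hpos : 0 < (n : ℝ) * Real.log 2 := by positivity
    rw [Real.rpow_neg hpos.le, inv_le_comm₀ (Real.rpow_pos_of_pos hpos _) hε₁0]
    calc ε₁⁻¹ = (ε₁⁻¹ ^ (200 : ℕ)) ^ ((200 : ℕ) : ℝ)⁻¹ :=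
          (Real.pow_rpow_inv_natCast (inv_nonneg.mpr hε₁0.le) (by norm_num)).symm
      _ ≤ ((n : ℝ) * Real.log 2) ^ ((200 : ℕ) : ℝ)⁻¹ :=
          Real.rpow_le_rpow (by positivity) hnlog (by positivity)
      _ = ((n : ℝ) * Real.log 2) ^ (1 / 200 : ℝ) := by norm_num
  -- smoothness: `2 ≤ (2^k)^{e'}` since `k e' ≥ 1`
  have hke : 1 ≤ (k : ℝ) * e' := by
    have h1 : e'⁻¹ ≤ k := hK.trans hkK
    rw [inv_le_iff_one_le_mul₀ he'0] at h1
    linarith [mul_comm (k : ℝ) e']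
  have hsmooth : (2 : ℝ) ≤ ((2 : ℝ) ^ k) ^ e' := by
    rw [← Real.rpow_natCast, ← Real.rpow_mul (by norm_num : (0 : ℝ) ≤ 2)]
    calc (2 : ℝ) = 2 ^ (1 : ℝ) := (Real.rpow_one 2).symm
      _ ≤ 2 ^ ((k : ℝ) * e') := Real.rpow_le_rpow_of_exponent_le one_le_two hke
  -- typicality: `541 ≤ (2^n)^{ε₁²}` since `n ε₁² ≥ 10`
  have hnε : 10 ≤ (n : ℝ) * ε₁ ^ 2 := by
    have := le_trans hN₂ hnN₂
    rwa [div_le_iff₀ (by positivity)] at this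
  have htyp : (541 : ℝ) ≤ (x / 2 ^ k) ^ (ε₁ ^ 2) := by
    rw [hxq, ← Real.rpow_natCast, ← Real.rpow_mul (by norm_num : (0 : ℝ) ≤ 2)]
    calc (541 : ℝ) ≤ 2 ^ (10 : ℝ) := by norm_num
      _ ≤ 2 ^ ((n : ℝ) * ε₁ ^ 2) := Real.rpow_le_rpow_of_exponent_le one_le_two hnε
  -- apply Theorem 1.3
  obtain ⟨χ₁, hχ⟩ := hT ε₁ x k hε₁0 hε₁1 hk1 hx10 hεlog hsmooth htyp
  refine ⟨χ₁, ?_⟩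
  -- match the sums
  have hmain : (∑ m : Fin (2 ^ (n + k)), ((liouville ((m : ℕ) + 1) : ℤ) : ℂ) *
      star (χ₁ (((m : ℕ) + 1 : ℕ) : ZMod (2 ^ k)))) =
      ∑ m ∈ Finset.Icc 1 ⌊x⌋₊, (liouville m : ℂ) * star (χ₁ (m : ZMod (2 ^ k))) := by
    have hfloor : ⌊x⌋₊ = 2 ^ (n + k) := by
      rw [hx, show ((2 : ℝ) ^ (n + k)) = ((2 ^ (n + k) : ℕ) : ℝ) by push_cast; rfl, Nat.floor_natCast]
    rw [hfloor]
    exact sum_fin_succ_eq_sum_Icc (fun m => (liouville m : ℂ) * star (χ₁ (m : ZMod (2 ^ k)))) _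
  have hlhs : (∑ u : (ZMod (2 ^ k))ˣ,
      ‖(∑ b : Fin (2 ^ n), ((liouville ((u : ZMod (2 ^ k)).val + 2 ^ k * (b : ℕ)) : ℤ) : ℂ))
        - χ₁ (u : ZMod (2 ^ k)) / (Nat.totient (2 ^ k) : ℂ) *
          ∑ m : Fin (2 ^ (n + k)), ((liouville ((m : ℕ) + 1) : ℤ) : ℂ) *
            star (χ₁ (((m : ℕ) + 1 : ℕ) : ZMod (2 ^ k)))‖ ^ 2) =
      ∑ a : (ZMod (2 ^ k))ˣ,
        ‖(∑ m ∈ (Finset.Icc 1 ⌊x⌋₊).filter (fun m : ℕ => (m : ZMod (2 ^ k)) = (a : ZMod (2 ^ k))),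
            (liouville m : ℂ)) -
          χ₁ (a : ZMod (2 ^ k)) / (Nat.totient (2 ^ k) : ℂ) *
            ∑ m ∈ Finset.Icc 1 ⌊x⌋₊, (liouville m : ℂ) * star (χ₁ (m : ZMod (2 ^ k)))‖ ^ 2 := by
    refine Finset.sum_congr rfl fun u _ => ?_
    rw [hmain, sum_units_progression_eq n k u hk1]
  rw [hlhs]
  refine hχ.trans ?_
  -- `C₀ ε₁ φ(2^k) (x/2^k)² ≤ ε 2^k 4^n`
  have hφ : (Nat.totient (2 ^ k) : ℝ) ≤ 2 ^ k := by exact_mod_cast Nat.totient_le (2 ^ k)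
  have h4 : (x / 2 ^ k) ^ 2 = (4 : ℝ) ^ n := by
    rw [hxq, ← pow_mul, show (4 : ℝ) = 2 ^ 2 by norm_num, ← pow_mul, mul_comm]
  rw [h4]
  calc C₀ * ε₁ * (Nat.totient (2 ^ k) : ℝ) * 4 ^ n = (C₀ * ε₁) * ((Nat.totient (2 ^ k) : ℝ) * 4 ^ n) := by ring
    _ ≤ ε * ((2 : ℝ) ^ k * 4 ^ n) := by gcongr
    _ = ε * 2 ^ k * 4 ^ n := by ring

end Summit.ValiantsHypothesis.ValiantsHypothesis.Theorems.LiouvilleSarnak.AlignedTypeI.CharactersModTwoN
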